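import Summits.BirchSwinnertonDyer.Rank1Residual.X1.PadicSigmaThreeExistence
import HarnessLib

/-!
# Unconditional consequences of `mazur_tate_sigma_exists_odd_holds`: the Mazur–Tate sigma pair and
# the canonical cyclotomic `p`-adic height at EVERY odd good ordinary prime (x1a gen 20)

HONEST FRAMING (cell `b2b-bsdres`, run/shared/lean/b2b/bsd-rank1-residual/, verbatim in every file):
the goal of the cell is to DELETE the COMBINATION-SHAPED residual classes of the Birch–Swinnerton-Dyer
formula for ALL analytic-rank `≤ 1` elliptic curves over `ℚ` — "full BSD formula for every rank `≤ 1`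
curve in class `C`" assembled STRICTLY from published theorems — so that the rank-`≤ 1` remainder
becomes exactly the CONSTRUCTION-SHAPED classes, which are TYPED (missing-input `Prop`s), NOT
attempted. This is not "finishing BSD". CLASS-OWNERS.md row "X1 (r = 1)": research route; NO CLAIM
BEYOND STATED CLASSES; nothing is booked by this file; no preprint enters; no named fact.

Unit `b2b-bsdres-x1a` (X1 prover A, gen 20). WHAT. The tree's `PadicSigmaOddPrime.lean` derives from the
named fact `mazur_tate_sigma_exists_odd` (binder A34): uniqueness-and-existence of the Mazur–Tate pair,
that the chosen `padicSigma` IS a pair, and the existence (and uniqueness) of THE canonical cyclotomic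
`p`-adic height datum, at every odd good ordinary prime. With `mazur_tate_sigma_exists_odd_holds`
(`X1/PadicSigmaThreeExistence.lean`: `p = 3` by the x1a design, `p ≥ 5` by Blakestad–Grant in the tree)
these become UNCONDITIONAL theorems: `mazur_tate_sigma_existsUnique_odd`, `isMazurTateSigmaPair_padicSigma_odd`,
`exists_isCanonical_odd`, `existsUnique_isCanonical_odd` — the forms the cell's `p = 3` records consume.

References: B. Mazur, W. Stein, J. Tate, Doc. Math. Extra Vol. (2006) Thm 1.3 [MazurSteinTate2006];
J. S. Balakrishnan, J. Number Theory 161 (2016) §2 [Balakrishnan2016].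

Pure proof file: no definitions, no named facts, no `sorry`.
-/

noncomputable section

open PowerSeries WeierstrassCurve Literature.NumberTheory.EllipticCurves

namespace Summit.BirchSwinnertonDyer.Rank1Residual.X1.PadicSigmaThree

/-- **Exactly one Mazur–Tate pair at every odd good ordinary prime**, unconditionally.
[cite: MazurSteinTate2006, Thm. 1.3] -/
theorem mazur_tate_sigma_existsUnique_odd (W : WeierstrassCurve ℚ) [W.IsElliptic] [W.IsGloballyMinimal]
    (p : ℕ) [Fact p.Prime] (hp2 : p ≠ 2) (hgood : W.HasGoodReductionAtPrime p) (hord : ¬ (p : ℤ) ∣ W.frobeniusTrace p) :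
    ∃! σc : ℚ_[p]⟦X⟧ × ℚ_[p], (W.baseChange ℚ_[p]).IsMazurTateSigmaPair σc.1 σc.2 :=
  mazur_tate_sigma_existsUnique_of_odd mazur_tate_sigma_exists_odd_holds W p hp2 hgood hord

/-- **The tree's chosen pair `(padicSigma, padicSigmaConst)` of `W ⊗ ℚ_p` IS the Mazur–Tate pair** at every
odd good ordinary prime, unconditionally. [cite: MazurSteinTate2006, Thm. 1.3] -/
theorem isMazurTateSigmaPair_padicSigma_odd (W : WeierstrassCurve ℚ) [W.IsElliptic] [W.IsGloballyMinimal]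
    (p : ℕ) [Fact p.Prime] (hp2 : p ≠ 2) (hgood : W.HasGoodReductionAtPrime p) (hord : ¬ (p : ℤ) ∣ W.frobeniusTrace p) :
    (W.baseChange ℚ_[p]).IsMazurTateSigmaPair (W.baseChange ℚ_[p]).padicSigma (W.baseChange ℚ_[p]).padicSigmaConst :=
  isMazurTateSigmaPair_padicSigma_of_odd mazur_tate_sigma_exists_odd_holds W p hp2 hgood hord

/-- **THE canonical cyclotomic `p`-adic height exists at every odd good ordinary prime** (`p = 3` included),
unconditionally. [cite: Balakrishnan2016, §2 (display before (2.2))] [cite: MazurSteinTate2006, §1 eq. (1.1)] -/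
theorem exists_isCanonical_odd (W : WeierstrassCurve ℚ) [W.IsElliptic] [W.IsGloballyMinimal]
    (p : ℕ) [Fact p.Prime] (hp2 : p ≠ 2) (hgood : W.HasGoodReductionAtPrime p) (hord : ¬ (p : ℤ) ∣ W.frobeniusTrace p) :
    ∃ D : PAdicHeightData W p, D.IsCanonical :=
  exists_isCanonical_of_odd mazur_tate_sigma_exists_odd_holds W p hp2 hgood hord

/-- … and it is unique. [cite: Balakrishnan2016, §2 (display before (2.2))] -/
theorem existsUnique_isCanonical_odd (W : WeierstrassCurve ℚ) [W.IsElliptic] [W.IsGloballyMinimal]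
    (p : ℕ) [Fact p.Prime] (hp2 : p ≠ 2) (hgood : W.HasGoodReductionAtPrime p) (hord : ¬ (p : ℤ) ∣ W.frobeniusTrace p) :
    ∃! D : PAdicHeightData W p, D.IsCanonical :=
  existsUnique_isCanonical_of_odd mazur_tate_sigma_exists_odd_holds W p hp2 hgood hord

end Summit.BirchSwinnertonDyer.Rank1Residual.X1.PadicSigmaThree

end
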